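import Summits.QuantumFields.YangMills.Theorems.ColdStartUniversalityLatticeLangevinFeynmanKacSkeleton
import Summits.QuantumFields.YangMills.Theorems.ColdStartUniversalityLatticeLangevinHypercontractiveDecorrelation
import HarnessLib

/-!
# Route `ColdStartUniversality` (fixed-cut-off SZZ dynamics, sampler statistics): ★★★ VOLUME-FREE EXPONENTIAL MOMENTS AND BERNSTEIN
# TAILS FOR DISCRETE SAMPLES OF ALL BOUNDED OBSERVABLES after the `O(log L)` burn-in, `|β'| < 1/12` (Lezaud's Chernoff bound)

Helper file (seat `ym-line-csu-p1`, g37; `--supports stmt-QuantumFields-24809`).  SU(2) lattice Langevin dynamics of Shen–Zhu–Zhu at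
`(L, β')` with `|β'| < 1/12`, Wilson measure `μ = μ_{β'}`, strong solutions `U` from a deterministic start on ANY filtered probability space,
burn-in `a = 2 + t₀ + u` with `log B ≤ 2(1 − 12|β'|)t₀` (`B = 96|β'|#E + 10|β'|#𝒫 + log 2 + #E·log(3/2) = O(L³)`, so `t₀ = O(log L)`).
g34's Hoeffding inequalities for the sampler (`…TimeAverageHoeffding`, `…DiscreteSamplingHoeffding`) hold for every observable with the
HARRIS constants `C, c` of the volume; their volume-free versions (g34 `…Uniform`) need LOCAL `C⁵` observables (gradient bounds).  Lezaud's
`L²` method needs neither: the two inputs are the `L²`-WARM START delivered by hypercontractivity (g36, `…HypercontractiveDecorrelation`)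
and the volume-uniform `L²` gap `1 − 12|β'|` (g25), fed into the discrete Feynman–Kac bound `integral_exp_skeleton_sum_le` (g37):

* ★★ `coldStart_warmStart_uniform` — the `L²`-WARM START ALONG TRAJECTORIES: for every bounded measurable `φ` and `u ≥ 0`,
  `|E φ(U_{2+t₀+u})| ≤ e · (∫ φ² dμ_{β'})^{1/2}`;
* ★★★ `coldStart_integral_exp_skeleton_sum_le_uniform` — for EVERY bounded measurable `G` with `|G − μG| ≤ b`, `Var_μ(G) ≤ σ²`, every
  `θ ≥ 0`, step `h > 0` with `θhb ≤ 1`, `c_h > 0`, and every `n`: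
  `E[exp(θh Σ_{k≤n} (G(U_{2+t₀+u+kh}) − μG))] ≤ e · e^{θhb} · m_hⁿ`, `m_h = 1 + h·θ²σ²/(λ − θb) + O(h²)`, `λ = 1 − 12|β'|`
  — NO dependence on `L` except through the burn-in;
* ★★★ `coldStart_skeleton_tail_le_uniform` — the Chernoff/BERNSTEIN TAIL for the empirical mean of `n+1` samples at spacing `h`:
  `P[(n+1)⁻¹ Σ_{k≤n} G(U_{2+t₀+u+kh}) − μG ≥ ε] ≤ e · e^{θhb} · m_hⁿ · e^{−θh(n+1)ε}`, every `θ` as above.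

[cite: Lezaud2001, Theorem 1.1 and Remark 1.2] [cite: DiaconisSaloffcoste1996, Theorem 3.7].  THEOREMS ONLY, no definition, no sorry.  HONEST
FRAMING: RECORD-rung R3 plumbing at FIXED cut-off in LATTICE units; "volume-free" refers to `L` at fixed `|β'| < 1/12` (high temperature),
the burn-in is `O(log L)`; the route's scaling `β'_K → ∞` leaves the window; `UniformColdStartMixing` (24809) is NOT restated; nothing
K-uniform is proved; no crux, rung or summit statement is proved; the Yang–Mills mass gap is NOT proved.
-/

set_option autoImplicit false

noncomputable section

namespace Summit.QuantumFields.YangMills.Theorems.ColdStartUniversality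

open MeasureTheory ProbabilityTheory Filter Set
open scoped BigOperators NNReal ENNReal
open Literature.Probability.Process Literature.MathematicalPhysics.QuantumFieldTheory
open Literature.MathematicalPhysics.QuantumLattice (fundamentalRep fundamentalLatticeRep continuous_fundamentalRep)

variable {L : ℕ} [NeZero L]

/-! ## §1. The `L²`-warm start along trajectories -/

/-- ★★ **`L²`-warm start along the cold-start trajectory, `|β'| < 1/12`.**  For every `L`, every deterministic start `z`, EVERY strong
solution `U` from `z` on ANY filtered probability space, every bounded measurable `φ`, all lattice times `t₀, u` with
`log B ≤ 2(1 − 12|β'|)t₀` (`B = 96|β'|#E + 10|β'|#𝒫 + log 2 + #E·log(3/2)`):  `|E φ(U_{2+t₀+u})| ≤ e · (∫ φ² dμ_{β'})^{1/2}` — the law of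
`U_{2+t₀+u}` has an `L²(μ_{β'})`-density of norm at most `e` (dual form; `law(U₂) ≤ e^B μ`, hypercontractivity over `t₀ + u`).
[cite: DiaconisSaloffcoste1996, Theorem 3.7] -/
theorem coldStart_warmStart_uniform (L : ℕ) [NeZero L] (β' : ℝ) (hβ : |β'| < 1 / 12)
    (z : GaugeConfig 3 L (Matrix.specialUnitaryGroup (Fin 2) ℂ))
    {Ω : Type} [MeasurableSpace Ω] {P : Measure Ω} [IsProbabilityMeasure P]
    {W : ℝ≥0 → Ω → (Edge 3 L × NoiseIdx 2 → ℝ)} (hW : IsFlatBrownian W P)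
    {U : ℝ≥0 → Ω → GaugeConfig 3 L (Matrix.specialUnitaryGroup (Fin 2) ℂ)} (hU0 : ∀ ω, U 0 ω = z)
    (hU : (latticeLangevinDynamics (fundamentalLatticeRep 2) β').IsSolution (fundamentalRep (Fin 2)) hW.natFiltration P W U)
    {φ : GaugeConfig 3 L (Matrix.specialUnitaryGroup (Fin 2) ℂ) → ℝ} (hφ : Measurable φ) {M : ℝ} (hM : ∀ x, |φ x| ≤ M) (t₀ u : ℝ≥0)
    (ht₀ : Real.log (96 * |β'| * (Fintype.card (Edge 3 L) : ℝ) + 10 * |β'| * (Fintype.card (Plaquette 3 L) : ℝ) + Real.log 2 +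
      (Fintype.card (Edge 3 L) : ℝ) * Real.log (3 / 2)) ≤ 2 * (1 - 12 * |β'|) * t₀) :
    |∫ ω, φ (U (2 + t₀ + u) ω) ∂P| ≤
      Real.exp 1 * (∫ x, φ x ^ 2 ∂(wilsonMeasure (d := 3) (L := L) (fundamentalRep (Fin 2)) β')) ^ (1 / (2 : ℝ)) := by
  classical
  haveI := secondCountableTopology_su2
  haveI := borelSpace_config L
  haveI : IsProbabilityMeasure (wilsonMeasure (d := 3) (L := L) (fundamentalRep (Fin 2)) β') :=
    isProbabilityMeasure_wilsonMeasure (d := 3) (L := L) (fundamentalRep (Fin 2)) (continuous_fundamentalRep (Fin 2)) β'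
  obtain ⟨κ, hκM, -, hreal⟩ := exists_transitionKernel L β'
  haveI := hκM
  -- the density bound at time `2`
  obtain ⟨hDe, hlogD⟩ := coldStart_density_constant_facts L β'
  obtain ⟨D, hDdef⟩ : ∃ D : ℝ, (Real.exp ((48 * |β'| * (Fintype.card (Edge 3 L) : ℝ)) * ((2 : ℝ≥0) : ℝ) +
      (2 * |β'| * (Fintype.card (Plaquette 3 L) : ℝ))) * (2 * (3 / 2 : ℝ) ^ Fintype.card (Edge 3 L))) *
      (Real.exp (|β'| * (4 * (Fintype.card (Plaquette 3 L) : ℝ))) * Real.exp (|β'| * (4 * (Fintype.card (Plaquette 3 L) : ℝ)))) = D :=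
    ⟨_, rfl⟩
  rw [hDdef] at hDe hlogD
  have hle₁ := map_le_smul_haar_explicit (L := L) β' (t := 2) (by norm_num) z hW hU0 hU
  obtain ⟨-, hπle⟩ := wilsonMeasure_le_smul_pi_haar_and_explicit (L := L) β'
  have hν : P.map (U 2) ≤ (ENNReal.ofReal D) • wilsonMeasure (d := 3) (L := L) (fundamentalRep (Fin 2)) β' := by
    rw [← hDdef, ENNReal.ofReal_mul (by positivity), Measure.le_iff]
    intro A hA
    have e1 := Measure.le_iff.1 hle₁ A hA
    have e2 := Measure.le_iff.1 hπle A hA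
    simp only [Measure.smul_apply, smul_eq_mul] at e1 e2 ⊢
    calc (P.map (U 2)) A ≤ _ := e1
      _ ≤ _ := mul_le_mul' le_rfl e2
      _ = _ := (mul_assoc _ _ _).symm
  have hmU : ∀ r : ℝ≥0, Measurable (U r) := fun r => (hU.adapted r).mono (hW.natFiltration.le r) le_rfl
  haveI : IsProbabilityMeasure (P.map (U 2)) := Measure.isProbabilityMeasure_map (hmU 2).aemeasurable
  have ht₀' : Real.log (Real.log D) ≤ 4 * ((1 - 12 * |β'|) / 2) * t₀ := by rw [hlogD]; linarith
  -- `E φ(U_{2+t₀+u}) = ∫ κ_{t₀+u} φ d law(U₂)`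
  have hE2 : ∫ ω, φ (U (2 + t₀ + u) ω) ∂P = ∫ y, (∫ y', φ y' ∂(κ (t₀ + u) y)) ∂(P.map (U 2)) := by
    rw [← integral_map (hmU _).aemeasurable hφ.aestronglyMeasurable, ← hreal (2 + t₀ + u) z Ω P W hW U hU0 hU, add_assoc,
      chapmanKolmogorov_szz β' κ hreal 2 (t₀ + u), ← hreal 2 z Ω P W hW U hU0 hU]
    haveI : IsProbabilityMeasure ((κ (t₀ + u) ∘ₖ κ 2) z) := by
      rw [← chapmanKolmogorov_szz β' κ hreal 2 (t₀ + u)]; infer_instance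
    exact Kernel.integral_comp (FeynmanKac.integrable_of_measurable_of_abs_le _ hφ hM)
  rw [hE2]
  have hρ : 0 ≤ (1 - 12 * |β'|) / 2 := by linarith
  have hwarm := abs_integral_transition_le_exp_mul_of_warm L β' κ hreal hρ
    (fun g hg => wilson_generatorLogSobolev_uniform L β' hβ g hg) hDe hν ht₀' hφ hM u
  have hconv : ∫ x, |φ x| ^ (2 : ℝ) ∂(wilsonMeasure (d := 3) (L := L) (fundamentalRep (Fin 2)) β') =
      ∫ x, φ x ^ 2 ∂(wilsonMeasure (d := 3) (L := L) (fundamentalRep (Fin 2)) β') :=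
    integral_congr_ae (ae_of_all _ fun x => by
      show |φ x| ^ (2 : ℝ) = φ x ^ 2
      rw [Real.rpow_two, sq_abs])
  rw [hconv] at hwarm
  exact hwarm

/-! ## §2. Volume-free exponential moments of the skeleton sums -/

/-- ★★★ **VOLUME-FREE EXPONENTIAL MOMENTS OF DISCRETE SAMPLES after the `O(log L)` burn-in, `|β'| < 1/12`.**  For every `L`, `|β'| < 1/12`
(`λ := 1 − 12|β'|`), every deterministic start `z`, EVERY strong solution `U` from `z` on ANY filtered probability space, EVERY bounded
measurable `G` with `|G − μ_{β'}G| ≤ b` (`b ≥ 0`) and `Var_{μ_{β'}}(G) ≤ σ²` (`σ > 0`), every `θ ≥ 0`, all `t₀, u` with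
`log B ≤ 2λt₀`, every step `h > 0` with `θhb ≤ 1` and `c_h := 1 − e^{−λh} − e^{−λh}θhb > 0`, and every `n`:

  `∫ exp(θh · Σ_{k<n+1} (G(U_{2+t₀+u+kh}) − μ_{β'}G)) dP ≤ e · e^{θhb} · m_hⁿ`,
  `m_h = 1 + e^{−2λh}θ²h²σ²/c_h + e^{−λh}(θhb)² + 3(1 − e^{−λh})θhb = 1 + h·θ²σ²/(λ − θb) + O(h²)` (`lezaud_rate_bound`).

Neither the prefactor nor `m_h` depends on `L` (warm start `coldStart_warmStart_uniform`, volume-uniform gap `wilson_spectralGap_uniform_measurable`,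
`integral_exp_skeleton_sum_le`). [cite: Lezaud2001, Theorem 1.1 and Remark 1.2] [cite: DiaconisSaloffcoste1996, Theorem 3.7] -/
theorem coldStart_integral_exp_skeleton_sum_le_uniform (L : ℕ) [NeZero L] (β' : ℝ) (hβ : |β'| < 1 / 12)
    (z : GaugeConfig 3 L (Matrix.specialUnitaryGroup (Fin 2) ℂ))
    {Ω : Type} [MeasurableSpace Ω] {P : Measure Ω} [IsProbabilityMeasure P]
    {W : ℝ≥0 → Ω → (Edge 3 L × NoiseIdx 2 → ℝ)} (hW : IsFlatBrownian W P)
    {U : ℝ≥0 → Ω → GaugeConfig 3 L (Matrix.specialUnitaryGroup (Fin 2) ℂ)} (hU0 : ∀ ω, U 0 ω = z)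
    (hU : (latticeLangevinDynamics (fundamentalLatticeRep 2) β').IsSolution (fundamentalRep (Fin 2)) hW.natFiltration P W U)
    {G : GaugeConfig 3 L (Matrix.specialUnitaryGroup (Fin 2) ℂ) → ℝ} (hG : Measurable G) {b σ : ℝ} (hb : 0 ≤ b)
    (hGb : ∀ x, |G x - ∫ y, G y ∂(wilsonMeasure (d := 3) (L := L) (fundamentalRep (Fin 2)) β')| ≤ b) (hσ : 0 < σ)
    (hσ2 : ∫ x, (G x - ∫ y, G y ∂(wilsonMeasure (d := 3) (L := L) (fundamentalRep (Fin 2)) β')) ^ 2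
      ∂(wilsonMeasure (d := 3) (L := L) (fundamentalRep (Fin 2)) β') ≤ σ ^ 2)
    {θ : ℝ} (hθ : 0 ≤ θ) (t₀ u h : ℝ≥0)
    (ht₀ : Real.log (96 * |β'| * (Fintype.card (Edge 3 L) : ℝ) + 10 * |β'| * (Fintype.card (Plaquette 3 L) : ℝ) + Real.log 2 +
      (Fintype.card (Edge 3 L) : ℝ) * Real.log (3 / 2)) ≤ 2 * (1 - 12 * |β'|) * t₀)
    (hh : 0 < (h : ℝ)) (hθhb : θ * h * b ≤ 1)
    (hc : 0 < 1 - Real.exp (-((1 - 12 * |β'|) * h)) - Real.exp (-((1 - 12 * |β'|) * h)) * (θ * h * b)) (n : ℕ) :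
    ∫ ω, Real.exp (θ * h * ∑ k ∈ Finset.range (n + 1),
        (G (U (2 + t₀ + u + (k : ℝ≥0) * h) ω) - ∫ y, G y ∂(wilsonMeasure (d := 3) (L := L) (fundamentalRep (Fin 2)) β'))) ∂P ≤
      Real.exp 1 * Real.exp (θ * h * b) *
        (1 + Real.exp (-((1 - 12 * |β'|) * h)) ^ 2 * (θ * h) ^ 2 * σ ^ 2 /
            (1 - Real.exp (-((1 - 12 * |β'|) * h)) - Real.exp (-((1 - 12 * |β'|) * h)) * (θ * h * b)) +
          Real.exp (-((1 - 12 * |β'|) * h)) * (θ * h * b) ^ 2 + 3 * (1 - Real.exp (-((1 - 12 * |β'|) * h))) * (θ * h * b)) ^ n := by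
  classical
  haveI : IsProbabilityMeasure (wilsonMeasure (d := 3) (L := L) (fundamentalRep (Fin 2)) β') :=
    isProbabilityMeasure_wilsonMeasure (d := 3) (L := L) (fundamentalRep (Fin 2)) (continuous_fundamentalRep (Fin 2)) β'
  obtain ⟨κ, hκM, -, hreal⟩ := exists_transitionKernel L β'
  haveI := hκM
  have hlam : 0 < 1 - 12 * |β'| := by linarith
  set m : ℝ := ∫ y, G y ∂(wilsonMeasure (d := 3) (L := L) (fundamentalRep (Fin 2)) β') with hm
  have hV : Measurable fun x => G x - m := hG.sub measurable_const
  obtain ⟨M, hM⟩ : ∃ M : ℝ, ∀ x, |G x| ≤ M :=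
    ⟨b + |m|, fun x => by
      calc |G x| = |(G x - m) + m| := by ring_nf
        _ ≤ |G x - m| + |m| := abs_add_le _ _
        _ ≤ b + |m| := add_le_add (hGb x) le_rfl⟩
  have hV0 : ∫ x, (G x - m) ∂(wilsonMeasure (d := 3) (L := L) (fundamentalRep (Fin 2)) β') = 0 := by
    rw [integral_sub (FeynmanKac.integrable_of_measurable_of_abs_le _ hG hM) (integrable_const m), integral_const, probReal_univ,
      one_smul, ← hm, sub_self]
  exact integral_exp_skeleton_sum_le L β' κ hreal hlam (fun hG' _ hM' t => wilson_spectralGap_uniform_measurable L β' hβ κ hreal hG' hM' t)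
    z hW hU0 hU (2 + t₀ + u) (Real.exp_pos 1).le (fun hφ _ hφM => coldStart_warmStart_uniform L β' hβ z hW hU0 hU hφ hφM t₀ u ht₀)
    hV hb hGb hσ hV0 hσ2 hθ h hh hθhb hc n

/-! ## §3. The Bernstein tail for empirical means of discrete samples -/

/-- ★★★ **VOLUME-FREE CHERNOFF–BERNSTEIN TAIL FOR DISCRETE SAMPLES after the `O(log L)` burn-in, `|β'| < 1/12`.**  In the setting of
`coldStart_integral_exp_skeleton_sum_le_uniform`, for every `ε`:

  `P[ (n+1)⁻¹ Σ_{k<n+1} G(U_{2+t₀+u+kh}) − μ_{β'}G ≥ ε ] ≤ e · e^{θhb} · m_hⁿ · exp(−θh(n+1)ε)`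

(Markov's inequality on the exponential moment).  With `T = (n+1)h` and `h → 0` the right side is `e·exp(−T(θε − θ²σ²/(λ − θb)) + o(1))`;
the choice `θ = λε/(2σ² + bε)` gives the Bernstein exponent `λTε²/(4σ² + 2bε)` (continuous-time form in the sequel).  The constants do NOT
depend on `L`. [cite: Lezaud2001, Theorem 1.1 and Remark 1.2] -/
theorem coldStart_skeleton_tail_le_uniform (L : ℕ) [NeZero L] (β' : ℝ) (hβ : |β'| < 1 / 12)
    (z : GaugeConfig 3 L (Matrix.specialUnitaryGroup (Fin 2) ℂ))
    {Ω : Type} [MeasurableSpace Ω] {P : Measure Ω} [IsProbabilityMeasure P]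
    {W : ℝ≥0 → Ω → (Edge 3 L × NoiseIdx 2 → ℝ)} (hW : IsFlatBrownian W P)
    {U : ℝ≥0 → Ω → GaugeConfig 3 L (Matrix.specialUnitaryGroup (Fin 2) ℂ)} (hU0 : ∀ ω, U 0 ω = z)
    (hU : (latticeLangevinDynamics (fundamentalLatticeRep 2) β').IsSolution (fundamentalRep (Fin 2)) hW.natFiltration P W U)
    {G : GaugeConfig 3 L (Matrix.specialUnitaryGroup (Fin 2) ℂ) → ℝ} (hG : Measurable G) {b σ : ℝ} (hb : 0 ≤ b)
    (hGb : ∀ x, |G x - ∫ y, G y ∂(wilsonMeasure (d := 3) (L := L) (fundamentalRep (Fin 2)) β')| ≤ b) (hσ : 0 < σ)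
    (hσ2 : ∫ x, (G x - ∫ y, G y ∂(wilsonMeasure (d := 3) (L := L) (fundamentalRep (Fin 2)) β')) ^ 2
      ∂(wilsonMeasure (d := 3) (L := L) (fundamentalRep (Fin 2)) β') ≤ σ ^ 2)
    {θ : ℝ} (hθ : 0 ≤ θ) (t₀ u h : ℝ≥0)
    (ht₀ : Real.log (96 * |β'| * (Fintype.card (Edge 3 L) : ℝ) + 10 * |β'| * (Fintype.card (Plaquette 3 L) : ℝ) + Real.log 2 +
      (Fintype.card (Edge 3 L) : ℝ) * Real.log (3 / 2)) ≤ 2 * (1 - 12 * |β'|) * t₀)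
    (hh : 0 < (h : ℝ)) (hθhb : θ * h * b ≤ 1)
    (hc : 0 < 1 - Real.exp (-((1 - 12 * |β'|) * h)) - Real.exp (-((1 - 12 * |β'|) * h)) * (θ * h * b)) (n : ℕ) (ε : ℝ) :
    P.real {ω | ε ≤ ((n : ℝ) + 1)⁻¹ * (∑ k ∈ Finset.range (n + 1), G (U (2 + t₀ + u + (k : ℝ≥0) * h) ω)) -
        ∫ y, G y ∂(wilsonMeasure (d := 3) (L := L) (fundamentalRep (Fin 2)) β')} ≤
      Real.exp 1 * Real.exp (θ * h * b) *
        (1 + Real.exp (-((1 - 12 * |β'|) * h)) ^ 2 * (θ * h) ^ 2 * σ ^ 2 /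
            (1 - Real.exp (-((1 - 12 * |β'|) * h)) - Real.exp (-((1 - 12 * |β'|) * h)) * (θ * h * b)) +
          Real.exp (-((1 - 12 * |β'|) * h)) * (θ * h * b) ^ 2 + 3 * (1 - Real.exp (-((1 - 12 * |β'|) * h))) * (θ * h * b)) ^ n *
        Real.exp (-(θ * h * ((n : ℝ) + 1) * ε)) := by
  classical
  set m : ℝ := ∫ y, G y ∂(wilsonMeasure (d := 3) (L := L) (fundamentalRep (Fin 2)) β') with hm
  have hmgf := coldStart_integral_exp_skeleton_sum_le_uniform L β' hβ z hW hU0 hU hG hb hGb hσ hσ2 hθ t₀ u h ht₀ hh hθhb hc n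
  rw [← hm] at hmgf
  set Bd : ℝ := Real.exp 1 * Real.exp (θ * h * b) *
    (1 + Real.exp (-((1 - 12 * |β'|) * h)) ^ 2 * (θ * h) ^ 2 * σ ^ 2 /
        (1 - Real.exp (-((1 - 12 * |β'|) * h)) - Real.exp (-((1 - 12 * |β'|) * h)) * (θ * h * b)) +
      Real.exp (-((1 - 12 * |β'|) * h)) * (θ * h * b) ^ 2 + 3 * (1 - Real.exp (-((1 - 12 * |β'|) * h))) * (θ * h * b)) ^ n with hBd
  -- the exponential functional and its measurability
  have hmU : ∀ r : ℝ≥0, Measurable (U r) := fun r => (hU.adapted r).mono (hW.natFiltration.le r) le_rfl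
  set F : Ω → ℝ := fun ω => Real.exp (θ * h * ∑ k ∈ Finset.range (n + 1), (G (U (2 + t₀ + u + (k : ℝ≥0) * h) ω) - m)) with hF
  have hFm : Measurable F :=
    Real.measurable_exp.comp ((Finset.measurable_sum _ fun k _ => (hG.comp (hmU _)).sub measurable_const).const_mul _)
  have hFb : ∀ ω, |F ω| ≤ Real.exp (θ * h * (((n : ℝ) + 1) * b)) := by
    intro ω
    rw [hF, abs_of_pos (Real.exp_pos _)]
    refine Real.exp_le_exp.2 (mul_le_mul_of_nonneg_left ?_ (mul_nonneg hθ h.coe_nonneg))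
    calc ∑ k ∈ Finset.range (n + 1), (G (U (2 + t₀ + u + (k : ℝ≥0) * h) ω) - m)
        ≤ ∑ k ∈ Finset.range (n + 1), |G (U (2 + t₀ + u + (k : ℝ≥0) * h) ω) - m| := Finset.sum_le_sum fun k _ => le_abs_self _
      _ ≤ ∑ _k ∈ Finset.range (n + 1), b := Finset.sum_le_sum fun k _ => hGb _
      _ = ((n : ℝ) + 1) * b := by rw [Finset.sum_const, Finset.card_range, nsmul_eq_mul]; push_cast; ring
  have hFi : Integrable F P := FeynmanKac.integrable_of_measurable_of_abs_le P hFm hFb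
  -- the deviation event is contained in `{exp(θh(n+1)ε) ≤ F}`
  have hsub : {ω | ε ≤ ((n : ℝ) + 1)⁻¹ * (∑ k ∈ Finset.range (n + 1), G (U (2 + t₀ + u + (k : ℝ≥0) * h) ω)) - m} ⊆
      {ω | Real.exp (θ * h * ((n : ℝ) + 1) * ε) ≤ F ω} := by
    intro ω hω
    simp only [Set.mem_setOf_eq] at hω ⊢
    rw [hF]
    refine Real.exp_le_exp.2 ?_
    have hn1 : (0 : ℝ) < (n : ℝ) + 1 := by positivity
    have hsum : ∑ k ∈ Finset.range (n + 1), (G (U (2 + t₀ + u + (k : ℝ≥0) * h) ω) - m) =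
        (∑ k ∈ Finset.range (n + 1), G (U (2 + t₀ + u + (k : ℝ≥0) * h) ω)) - ((n : ℝ) + 1) * m := by
      rw [Finset.sum_sub_distrib, Finset.sum_const, Finset.card_range, nsmul_eq_mul]; push_cast; ring
    have hε' : ((n : ℝ) + 1) * ε ≤ (∑ k ∈ Finset.range (n + 1), G (U (2 + t₀ + u + (k : ℝ≥0) * h) ω)) - ((n : ℝ) + 1) * m := by
      have := mul_le_mul_of_nonneg_left hω hn1.le
      rwa [mul_sub, ← mul_assoc, mul_inv_cancel₀ hn1.ne', one_mul] at this
    rw [hsum]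
    have hθh : 0 ≤ θ * h := mul_nonneg hθ h.coe_nonneg
    calc θ * h * ((n : ℝ) + 1) * ε = θ * h * (((n : ℝ) + 1) * ε) := by ring
      _ ≤ θ * h * ((∑ k ∈ Finset.range (n + 1), G (U (2 + t₀ + u + (k : ℝ≥0) * h) ω)) - ((n : ℝ) + 1) * m) :=
          mul_le_mul_of_nonneg_left hε' hθh
  -- Markov's inequality
  have hmarkov := mul_meas_ge_le_integral_of_nonneg (μ := P) (ae_of_all _ fun ω => (Real.exp_pos _).le) hFi
    (Real.exp (θ * h * ((n : ℝ) + 1) * ε))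
  have hexp0 : 0 < Real.exp (θ * h * ((n : ℝ) + 1) * ε) := Real.exp_pos _
  have hint : ∫ ω, F ω ∂P ≤ Bd := by rw [hF, hBd]; exact hmgf
  calc P.real {ω | ε ≤ ((n : ℝ) + 1)⁻¹ * (∑ k ∈ Finset.range (n + 1), G (U (2 + t₀ + u + (k : ℝ≥0) * h) ω)) - m}
      ≤ P.real {ω | Real.exp (θ * h * ((n : ℝ) + 1) * ε) ≤ F ω} := measureReal_mono hsub
    _ ≤ (∫ ω, F ω ∂P) / Real.exp (θ * h * ((n : ℝ) + 1) * ε) := by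
        rw [le_div_iff₀ hexp0, mul_comm]; exact hmarkov
    _ ≤ Bd / Real.exp (θ * h * ((n : ℝ) + 1) * ε) := div_le_div_of_nonneg_right hint hexp0.le
    _ = Bd * Real.exp (-(θ * h * ((n : ℝ) + 1) * ε)) := by rw [Real.exp_neg, div_eq_mul_inv]

end Summit.QuantumFields.YangMills.Theorems.ColdStartUniversality

end
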